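import Literature.MathematicalPhysics.QuantumFieldTheory.Balaban1983to89.B15Carve37Prop1RprimeHyp
import Literature.MathematicalPhysics.QuantumFieldTheory.Balaban1983to89.B15Claim179
import Literature.MathematicalPhysics.QuantumFieldTheory.Balaban1983to89.B15Claim184
import Literature.MathematicalPhysics.QuantumFieldTheory.Balaban1983to89.B15Rep163
import Literature.MathematicalPhysics.QuantumFieldTheory.Balaban1983to89.UnitaryModel

/-!
# `Balaban1983to89.B15Carve36BasicStepHyp` — [Balaban1989LargeFieldI] pp. 175–190 (Sect. 0 «Introduction», (0.1)–(0.6):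
# the operation 𝐑 (0.3), its normalization (0.4), the exponentiated form (0.5)–(0.6); Sect. 1 «The basic step of the
# operation 𝐑», (1.1)–(1.69): the class of components (i)–(ii) p. 177, the characteristic functions (1.3)–(1.9), the new
# large-field regions (1.10)–(1.13) and `N₀` p. 179, the determining sets (1.14)–(1.21), the preliminary integrations
# (1.22)–(1.28), the lemma (1.29) with its proof (1.30)–(1.52), the fluctuation field (1.53)–(1.60), the boundary terms
# (1.61)–(1.63) and the spaces (1.64)–(1.69)): P6 CARVING-FAN BLOCK 36 — the block's residual printed sentences in hypothesis
# form and ONE hypothesis bundle `Hyp` of the section's printed statements BY NAME, keyed to the consumer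
# (`stmt-QuantumFields-20542`, K1⁷, DAG node n12 [B15] = `DagBinding.B15Leaf` over `DagBinding.PrintedCarriers15`); with
# `b15Leaf_of_hyps`: the bundles of blocks 36 and 37 together ASSEMBLE `DagBinding.B15Leaf W` with no further hypothesis

statement-level skeleton of published theorems with citation tags; proofs where landed; nothing here is a claim about the
Yang–Mills mass gap

T. Bałaban, *Large field renormalization. I. The basic step of the 𝐑 operation*, Commun. Math. Phys. **122** (1989) 175–202,
doi:10.1007/BF01257412 `[Balaban1989LargeFieldI]` (cell paper "B15" = «[IV]» of [Balaban1989LargeFieldII]; printed page =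
PDF page + 174).  STATUS: published, refereed.  PDF held: `paper:balaban1989-cmp122-large-field-i`; pp. 175–190 [PDF 1–16]
read by this seat AS IMAGES (renders `run/shared/lean/pub/pub-balaban/b2b-balaban-ref1/pages/1989-cmp122-large-field-I/
…-p001-x2.png` … `-p016-x2.png`, 2026-08-28) and on the text layer (`p0001.txt` … `p0016.txt`, line locators below).
[III] = `[Balaban1988Convergent]` (B14); [I] = `[Balaban1987RG1]` (B12); [14] of [I]'s list = `[Balaban1985RegularSpaces]`;
[16] = `[Balaban1985UV3]`; [19, 20] = Gallavotti et al. (the method of p. 176).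

CITATION HEADER (lean-in-tree rule).  Cell `lit-balaban` (HOME `run/shared/lean/pub/lit-balaban/`), P6 CARVING FAN
(D-0154 (3b)), block 36 of `carve/BLOCKS-31-40.md` v1.1 (lead g30, 2026-08-28T05:52Z; claimed by seat `carve-03` g3 under
RULING #7 (5) ∕ RULING #8, `carve/STATUS.md` 07:25Z ∕ 07:30Z): «[B15] pp. 175–190, Sect. 0 (0.1)–(0.6) basic step of 𝐑 + Sect. 1
(1.1)–(1.69) (inductive hypothesis p.182); 73 SKELETON rows; KEY stmt-QuantumFields-20542, also-feeds 20544, 20541».  Filed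
`--supports stmt-QuantumFields-20542`.  RULES (`carve/CARVE-RULES.md` §2): IN TREE = CITE, NEVER RESTATE; residual printed
statements in hypothesis form `def …Printed : Prop`; ONE bundle `Hyp`; no `instance`, no `notation`, 0 `sorry`.

## WHAT THE BLOCK'S PAGES PRINT AND WHERE THE TREE HOLDS IT (cite table — every SKELETON row of the block is IN TREE;
## nothing in this table is restated below)
* rows B15.Eq0.1 … B15.Eq0.6, B15.Def§0, B15.Eq0.2-0.6 — (0.1) p. 175: `Step.exp_neg_p0Profile_eq_rpow`; (0.2)–(0.6) p. 176:
  `B15.RData`, `B15.Rop` ((0.3), with the printed proviso quoted), `B15.Normalization04` ((0.4)), `B15.ExpForm06` ((0.5)–(0.6)),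
  the `Setup` forms `LargeFieldDecomp` ∕ `PreservesIntegral`, and the CONCRETE mechanism `B15.BasicStep.Rop03`, `RopReal`,
  `lmarginal_ratio_term`, `lintegral_rop03`, `integral_normTerm_eq`, `integral_ropReal_eq`, `preservesIntegral_of_rop` ((0.4)
  PROVED modulo the proviso «the denominators are positive»); the DAG binding `DagBinding.PrintedCarriers15`, `B15Leaf` (`n04`,
  `e06`), `Upstream.ofPrintedAll`.
* rows B15.Def§1.i, B15.Def§1.ii, B15.Claim@177, B15.Eq1.1 — p. 177: the class (i)–(ii) `B16StoppingRule.CondI`, `CondII`,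
  `StopAt`; «the size must be greater than 20MR_k … greater than 40MR_k … the minimal size is approximately equal to
  42(L/(L−1))MR_k» and «all the regions connected with the last N steps are rectangular parallelepipeds»: `B15Claim177` (`pbox`,
  `IsPBox`, `IsPBox.Sop`, with `Step.Budget.L_iter_lt_63`), `B15Eq112Parallelepipeds.boxComponents_zpp`; (1.1) = (2.19) [III]:
  `B14Components.tComp`, `TkOpsMarginal`.
* rows B15.Eq1.2 … B15.Eq1.9 — (1.2) p. 178: `B15IntegrationForms.Eq12` (PROVED in the operator model, `TkOpsMarginal.LocalSystem`);
  (1.3)–(1.9): `B15.PrelimIntegrations.SF13`, `SF15`, `gfDensity16`, `SF17`, `SF19` (definitions); `B15Eq13Concrete`.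
* rows B15.Def§1.N0, B15.Claim@179, B15.Eq1.10 … B15.Eq1.13 — p. 179: `N₀` = `B15.PrelimIntegrations.IsN0` ∕ `B15Claim179.IsN0`,
  `Eq179`, the claim «either there is exactly one such integer, or there are two» = `B15Claim179.Claim179` (PROVED under the
  [III] (2.9) gap hypothesis: `claim179_of`, `card_sols_le_two`, `exists_sol`, `gapHyp_of_third_member`); (1.10)–(1.12):
  `B16Stage3Regions.Zk`, `Zk0`, `farZ`, `OmegaPP`; «complete these two sets to a sequence … the complements … form an admissible
  sequence» and «The sequence {Ω″_j} is an admissible sequence»: `B15Eq112Admissible` (`Admissible`, `completion`, PROVED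
  `admissible_completion`-type theorems there); «all components of the domains Z″_j are also rectangular parallelepipeds»:
  `B15Eq112Parallelepipeds.boxComponents_zpp`, `boxComponents_farZ_top`; (1.13): `B15DeterminingSets.genSetPP`; p. 179 (1.12)
  region hypotheses `B15Space164DescentSets.RegionHyp`, `CubeHyp`.
* rows B15.Eq1.14-1.16 … B15.Eq1.21 — (1.14)–(1.21) pp. 179–181: `B15DeterminingSets.detSetN`, `detSetN_top` ((1.17) PROVED),
  `bgN` ((1.18)), `detSetNZ` ((1.19)–(1.20)), `detSetTop` ((1.21)).
* rows B15.Eq1.22, B15.Claim@181, B15.Eq1.23, B15.Eq1.24, B15.IH@182 — (1.22)/(1.23) p. 181: `B15.PrelimIntegrations.SF122`,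
  `SF123`; the p. 181 claims «(1.22) imply that the characteristic functions (1.3) for j = h … are equal to 1», «(1.23) imply
  that all the functions (1.4) for j = h are equal to 1»: the schematic shape `B15.BasicStep.Claim129` (members `c181a`/`c181b`
  below); (1.24) pp. 181–182: `B15.BasicStep.SF149`, `SF151`, `lfFactor`, `B15.PrelimIntegrations.SF124c`, `cTop`, with the
  parameter clause «0 < β ≦ 1/2 … β = 1/2 … 2 ≦ L₀ < ½L, e.g., L₀ = ½(L − 1)» = `B15.BasicStep.params_instance` (and
  `l0_example_violates` for p. 191's tightening); the inductive assumption p. 182 «A_k^{(n)} … depends on the background field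
  U_k^{(n)}, and has the form (2.23) [III], with some new boundary terms»: `Step.LFActionData.action23`, `Step.LFTower` (the
  (2.23) [III] form), `B15IntegrationForms.form125` ((1.25)), `Data160` ((1.60)).
* rows B15.Eq1.25 … B15.Eq1.28 — (1.26) `B15DeterminingSets.vZ`; (1.27) `B15.PrelimIntegrations.SF127` (with
  `B15Ineq194Flow.deltaPrimeK` = `δ′_j = g_jA₁p₁(g_j)`, p. 183); (1.28) `decomp128`; the gauge invariance ∕ Faddeev–Popov sentence
  of p. 182 is bookkeeping of [III] Sect. 3 (`TkOpsMarginal`).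
* row B15.Eq1.29 — (1.29) p. 183 «Now we will prove that the restrictions introduced by the new characteristic functions imply
  that the functions (1.3), (1.4), (1.5), (1.7), (1.8), χ_k^{(n)} are equal to 1»: `B15.BasicStep.Claim129` (typed-existing),
  `claim129_iff_indicator`, assembled from the printed steps in `B15Claim129Assembly`, `B15Claim129Step`, `B15Claim129AtInstances`.
* rows B15.Eq1.30 … B15.Eq1.52, B15.Claim@184 — the PROOF of (1.29), pp. 183–187: (1.30) `B15StandardRep.Rep130`, `Layer130`;
  p. 184 «B₃exp(−δ2M₂R_j)22d²ε_j < (β/10)ε_j» and (1.31): `B15.BasicStep.expr131a`, `coeff131`, `coeff131_lt_one`, `expr131a_le`,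
  `B15Ineq131Input`, `B15Ineq131From190`, `B15GammaSmallness`; p. 184 claim ((1.5)-functions): `B15Claim184.Claim184`,
  `claim184_of_bondwise`, `smallness184`, `sf15_of_bondwise` (PROVED); (1.32)/(1.37)/(1.38)/(1.39)/(1.42): `B15.PrelimIntegrations.Ineq132`,
  `Ineq137`, `Ineq138`, `Ineq139`, `Ineq142`, `sf18_of_132_139_142` (PROVED), `B15Ineq137Proof`, `B15Ineq139From190`,
  `B15Ineq142Proof`; (1.33) `B15DeterminingSets.vSeam133`; (1.34)–(1.36), (1.40)–(1.41), (1.44): `B15StandardRep.Rep134`, `Rep135`,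
  `Rep136`, `Rep140`, `Rep141`, `Rep144`; (1.43): `B15.BasicStep.ineq143_iff`; p. 185 «if γ is sufficiently small … bounded by
  ½δ_j» and p. 186 «We choose M large enough, so that δ(M/M₁) ≧ 2 … exp(−(j − i)) … 9B₃(A₁/A₀)(p₁(γ)/p₀(γ))(1 + β₀) … 8B₃L^{−i}δ′_j <
  8B₃γA₁p₁(γ) … in the form αβ»: `B15.BasicStep.sqrt_exp_estimate`, `B15GammaClauses.alpha1_clause148_of_gamma`,
  `alpha2_clause148_of_gamma`, `exists_gamma0_clauses`, `exists_M0_clauses` (PROVED), `B15GammaSmallness`; (1.45)–(1.48):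
  `B15.PrelimIntegrations.Ineq145`, `Ineq146`, `Ineq147` (`ineq147_of_dist`), `B15.BasicStep.Ineq148`, `B15Ineq146Proof`,
  `B15Ineq148Proof`, `B15Ineq147Admissible`, `B15Ineq147LevelGap`; (1.49)–(1.52): `B15.BasicStep.SF149`, `ineq150`, `coeff150_eq`,
  `coeff150_le_coeff149_iff` («implies (1.49) if 8α ≦ 1»), `sf149_step`, `SF151`, `coeff152`, `coeff152_lt_one` («under … β₀ ≦ 1/2,
  β ≦ 1/2, L₀ < ½L, and α ≦ 1/4 … α = 1/8»), `ineq152_middle` (PROVED).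
* rows B15.Eq1.53 … B15.Eq1.59 — (1.53)/(1.54) p. 187: `B15.PrelimIntegrations.fluct153`, `dist1_fluct_le`, `ineq154` (PROVED;
  «the second expression … much smaller than δ′_j. This we will show later» typed `< δ′_j`), «|B′_j| < 6δ′_j»: `B15Ineq154Proof`,
  `B15Ineq154From190`; (1.55) `SF155`; (1.56) `B15StandardRep.Rep156`, `Layer156` («support in the boundary layer of the width
  2M₁ … bounded by 44d²B₃ε_k»); (1.57) `B15.BasicStep.Ineq157`, `B15Ineq157Flow` (PROVED along the flow); (1.58)
  `B15StandardRep.Rep158`, «bounded by O(1)exp(−R_j)ε_j»: `B15Ineq158Bound`; (1.59) `SF159`.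
* rows B15.Eq1.60 … B15.Eq1.63 — (1.60) `B15IntegrationForms.Data160`; (1.61)/(1.62) `B15.PrelimIntegrations.bdryTerms`,
  `bdryTerms_succ`; (1.63) p. 189 «X ⊂ Ω^c_{m+1} for some m ≧ j + 1, X∩Ω_m ≠ ∅, X∈𝔻_m, and X∩(Z_{j+1}∖Z″_{j+1}) ≠ ∅» and «For
  a given X there is a minimal index m»: `B15Rep163.Cond163`, `doms163`, `Cond163.minimal`, `scale_unique` (PROVED), `Rep163`.
* row B15.Eq1.64-1.69 — (1.64)–(1.69) p. 190 (–191): `B15.ComplexSpaces.Clause164`, `Clause166`, `Clause168`, `Cube165`,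
  `B15RegularSpaces164.CConsts`, `space164`, `Satisfies164` (the spaces `Ũ^{(n)c}_k(X, α̃₀, α̃₁)` with (i)–(iii)).
* row B15.§1 («(1.10)–(1.98): the basic step», no decl token in CARVE-LIST): the section as a whole is the union of the rows above
  and of block 37's (`B15Carve37Prop1RprimeHyp`); its end product is 𝐑′ (1.100) = `B15Sect1Statements.rPrime1100` with (1.102).

## WHAT THIS FILE ADDS
§1 TWO RESIDUAL PRINTED SENTENCES with no declaration of record (searched: `rg` over `Balaban1983to89/B15*.lean`, `B16*.lean`;
the first appears only as quoted prose in the docstring of `B15.Rop` and as hypotheses `hden` of the (0.4) theorems, the second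
nowhere), typed in hypothesis form, each with a kernel-checked companion:
* `Proviso03Printed` — p. 176 ll. 14–16: «We will prove that the densities are positive, and the in[t]egration domains in the
  integrals above are nonempty, hence the denominators are positive, and the operation 𝐑 is well defined.» over the abstract
  integration datum `B15.RData` of (0.2)–(0.6) (`den_ne_zero_of_proviso03`: hence no denominator of (0.3) vanishes);
* `Localized183Printed` — p. 183 ll. 12–15: «all the characteristic functions introduced above depend on the field variables
  localized in the corresponding components of the large field region Z_k. This is an important part of the inductive assumption
  for the effective density, more precisely for the operation 𝕋_k(Z_k).» (`Localized183Printed.eq_of_agree`).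
§2 THE BUNDLE.  `Carriers W` — the parameters the section's printed statements take beyond `W : DagBinding.PrintedCarriers15`
(plain data, no instances); `Hyp W X` — the section's printed STATEMENTS as hypotheses BY NAME: (0.4) `B15.Normalization04`,
(0.5)–(0.6) `B15.ExpForm06`, the p. 176 proviso, p. 179 `B15Claim179.IsN0` ∕ `Claim179` and «N > N₀», the two p. 181 claims and
the lemma (1.29) as `B15.BasicStep.Claim129`, the p. 183 locality sentence, the p. 184 claim `B15Claim184.Claim184`, (1.48)
`B15.BasicStep.Ineq148`, (1.57) `B15.BasicStep.Ineq157`, (1.63) `B15Rep163.Cond163` — and the closing bookkeeping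
`b15Leaf_of_hyps`: `Hyp W X` (block 36: supplies (0.4), (0.6)) and `B15Carve37Prop1RprimeHyp.Hyp W X′` (block 37: Prop 1,
(1.80), (1.89), (1.102)) give the DAG's `rBasicStep` leaf `DagBinding.B15Leaf W` (node n12 → K1⁷ 20542) with nothing else.
§3 (v1.1, lane-1 SECOND READ check-1 g0 M-c1-1, 2026-08-28T10:39:20Z; append-only — every v1 declaration is unchanged) THE p. 176 PROVISO IN
PRINT'S STRENGTH.  v1's `Proviso03Printed` types «the densities are positive» as `0 < ρ(Z, V)` at EVERY configuration; the
pieces of (0.2) ∕ (1.2) carry the sharp characteristic functions (1.3)–(1.5), (1.7)–(1.9) of p. 178 and vanish off their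
supports («the integration domains»), so v1's bundle `Hyp` is false on every such carrier (self-probe `carve/carve-36/Probe36.lean`).
`Proviso03Printed1` = nonnegative pieces ∧ positive denominators (the reading of the tree's (0.4) theorems
`B15.BasicStep.integral_ropReal_eq`, `B15LeafKnit.normalization04_knit`); `Hyp1` = `Hyp` with that slot (the bundle to consume);
`proviso03Printed1_of_v1`, `Hyp.toHyp1`, `b15Leaf_of_hyp1`, `Hyp1.den_ne_zero`, `Hyp1.piece_nonneg`, `Hyp1.n0_facts`, ….
§4 (v1.2, lead g32 RULING #13 (A) completion; append-only) THE KERNEL RECORD AND THE NON-VACUITY WITNESS, IN FILE.  RECORD: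
`not_hyp_of_piece_zero` — one vanishing value of one piece makes v1's `Hyp W X` false for every `X` (at the tree's pinned [IV]
carrier `B15LeafKnit.knitW15 κ` this is check-1 g0's `P36.not_hyp_knitW15`; cf. `B15LeafKnitMass`, GAPS G-B15-01); on the two-region
(0.2) datum `twoRegionDatum chiPiece` whose pieces are characteristic functions × weights (FAITHFUL: the cube's piece vanishes at the
small configuration; 𝐑 (0.3) is NOT the identity, (0.4) and (0.6) hold genuinely with `Σ_X 𝐑(X) = log(4/3)`): `not_proviso03Printed_faithful`,
`not_hyp_faithful` (v1 refuted there for every `X`) and the JOINT NON-DEGENERATE MODEL `hyp1_faithful : Hyp1 faithfulW faithfulX` of the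
v1.1 bundle (all 15 slots; `U(1)`-valued `PrintedCarriers15` filler from `UnitaryModel`; printed constants β = 1/2, α = 1/8, β₀ = 0;
strict (1.29) slots; non-empty (1.63) domain — `hyp1_faithful_nondegenerate`).  Models are plain `def`s (no `instance`, no `notation`).

## HONEST SCOPE
Nothing of [IV] is proved here beyond bookkeeping; (0.4) and (1.29) are NOT re-proved (hypothesis slots, as in
`DagBinding.B15Leaf` ∕ `B15.BasicStep.Claim129`); the proof displays (1.30)–(1.52) are cited, not bundled; the residual
sentences are typed schematically (reals ∕ abstract configurations), not on a lattice carrier; no summit statement is proved by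
this seat; count-neutral; nothing continuum ∕ ℝ⁴ ∕ OS ∕ mass-gap ∕ Clay.  No `sorry`, no `instance`, no `notation`.
-/

noncomputable section

namespace Literature.MathematicalPhysics.QuantumFieldTheory.Balaban1983to89.B15Carve36BasicStepHyp

open DagBinding (PrintedCarriers15 B15Leaf)
open B15.BasicStep (Claim129 Ineq148 Ineq157)
open B15Claim179 (IsN0 Claim179 sols)
open B15Claim184 (Claim184)
open B15Rep163 (Cond163 doms163)

/-! ## §1  Residual printed sentences of pp. 176 and 183 (hypothesis form) -/

/-- **p. 176, ll. 14–16 [PDF 2]** (`p0002.txt:L14–L16`), the proviso printed under (0.3), verbatim: «We will prove that the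
densities are positive, and the in[t]egration domains in the integrals above are nonempty, hence the denominators are positive,
and the operation 𝐑 is well defined.»  TYPED over the abstract integration datum `D : B15.RData` of (0.2)–(0.6) (whose `Rop`
carries this sentence as quoted prose and a junk value at a vanishing denominator): the pieces `ρ(Z, V)` are positive and every
denominator `∫dV⌈_{Z′}ρ(Z″, V)` of (0.3) is positive.  A PROMISE in print (proved in the series for the concrete densities); here
a hypothesis slot.  **SUPERSEDED (v1.1, check-1 g0 M-c1-1, 2026-08-28T10:39:20Z): conjunct 1 (`0 < ρ(Z, V)` at EVERY `V`) is stronger than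
print — the pieces carry the sharp characteristic functions (1.3)–(1.9) of p. 178 and vanish off their supports; the print-strength
form is `Proviso03Printed1` (§3), implied by this one (`proviso03Printed1_of_v1`); kept unchanged, append-only.**
[cite: Balaban1989LargeFieldI, (0.3) p.176 ll.14–16] -/
def Proviso03Printed (D : B15.RData) : Prop :=
  (∀ (Z : D.Reg) (V : D.Vsp), 0 < D.ρ Z V) ∧ ∀ Z : D.Reg, 0 < D.IntOver (D.Zp Z) (D.ρ (D.Zpp Z))

/-- «hence the denominators are positive, and the operation 𝐑 is well defined»: under the proviso no denominator of (0.3)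
(`B15.Rop`) vanishes. Bookkeeping. [cite: Balaban1989LargeFieldI, (0.3) p.176 ll.14–16] -/
theorem den_ne_zero_of_proviso03 {D : B15.RData} (h : Proviso03Printed D) (Z : D.Reg) :
    D.IntOver (D.Zp Z) (D.ρ (D.Zpp Z)) ≠ 0 :=
  (h.2 Z).ne'

/-- **p. 183, ll. 12–15 [PDF 9]** (`p0009.txt:L12–L15`), verbatim: «Let us notice that all the characteristic functions
introduced above depend on the field variables localized in the corresponding components of the large field region Z_k. This
is an important part of the inductive assumption for the effective density, more precisely for the operation 𝕋_k(Z_k).»  TYPED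
(schematic, functional reading of «depend on the field variables localized in …»): `I` = the characteristic functions
introduced on pp. 181–183 ((1.22)–(1.28)), `compOf i` = the component of `Z_k` the `i`-th one belongs to, `restrictTo c V` = the
field `V` with every variable outside the component `c` reset (any fixed projection onto the variables localized in `c`),
`χ i V` = the value of the `i`-th function: each `χ i` factors through the restriction to its own component.
[cite: Balaban1989LargeFieldI, p.183 ll.12–15] -/
def Localized183Printed {Cfg Comp I : Type*} (compOf : I → Comp) (restrictTo : Comp → Cfg → Cfg) (χ : I → Cfg → ℝ) :
    Prop :=
  ∀ (i : I) (V : Cfg), χ i V = χ i (restrictTo (compOf i) V)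

/-- Consequence of the locality sentence: two configurations with the same variables in the component of `χ_i` give the same
value of `χ_i`. Bookkeeping. [cite: Balaban1989LargeFieldI, p.183 ll.12–15] -/
theorem Localized183Printed.eq_of_agree {Cfg Comp I : Type*} {compOf : I → Comp} {restrictTo : Comp → Cfg → Cfg}
    {χ : I → Cfg → ℝ} (h : Localized183Printed compOf restrictTo χ) {i : I} {V V' : Cfg}
    (hV : restrictTo (compOf i) V = restrictTo (compOf i) V') : χ i V = χ i V' := by
  rw [h i V, h i V', hV]

/-! ## §2  The bundle: the printed statements of pp. 175–190 as hypotheses, by name, keyed to `DagBinding.B15Leaf` -/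

/-- **Carriers of the block-36 bundle** beyond the DAG record `W : DagBinding.PrintedCarriers15` (which already carries the
integration datum `W.D` of (0.2)–(0.6) with the (0.6) data `W.Zpp`, `W.ρpp`, `W.Rsum`) — one field per parameter of the
section's other printed statements, plain data: p. 179 — the exponents `s` of the sizes `R_j = L^{s_j}` ([III] (2.5)), the step
`k`, the number `N₀` and the number `N` of preliminary integrations; p. 181 — the configurations (`Cfg181`) with the restrictions
of (1.22) (`restr122`) ∕ (1.23) (`restr123`) and the conjunctions «the (1.3)-functions for j = h … equal 1» (`fn13h`) ∕ «the
(1.4)-functions for j = h equal 1» (`fn14h`); p. 183 — the characteristic functions (`I183`), the components of `Z_k` (`Comp183`),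
their fields (`Cfg183`) with `compOf`, `restrictTo`, `chi183`; (1.29) — the configurations (`Cfg129`) with «the restrictions
introduced by the new characteristic functions» (`new129`) and «the functions (1.3), (1.4), (1.5), (1.7), (1.8), χ_k^{(n)}»
(`old129`); p. 184 — the contour variables `|V_j(y, x) − 1|` (`I184`, `v184`), the `O(1)` (`C184`), `δ′_j` (`δ'j`), `ε_j` (`εj`);
(1.48) — the triples (i, y, p ∈ B^i(y)) (`I148`) with `|U^{(n)}_{k,Z}(∂p) − 1|` (`dev148`), `|U^{(n+1)}_{k,Z}(∂p) − 1|` (`dev148'`),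
`2^{−(j−i)}` (`s148`), `ε_i(L^{k−i}η)²` (`εE148`), and `α`, `β`; (1.57) — `|ℍ^{(n+1)}_{k,Z}|` (`H157`), `(L^{j+1}η)^{−1}` (`Lpow157`),
`R_{j+1} + ⋯ + R_{k−1}` (`sumR`), `R_k` (`Rk`), `R_j` (`Rj`), `d`, `ε_j` (`εj157`), `β₀` (with `B₃, δ, M, ε_k` from `W`); (1.63) —
the points (`Pt163`), regions `Ω_m` (`Ω163`), classes `𝔻_m` (`D163`), `Z_{j+1}` (`Zj1`), `Z″_{j+1}` (`Zppj1`), the step `j163`,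
and the summation domains of (1.63) (`terms163`). [cite: Balaban1989LargeFieldI, (0.2)–(1.69) pp.176–190] -/
structure Carriers (W : PrintedCarriers15) where
  s : ℕ → ℕ
  k : ℕ
  N₀ : ℕ
  N : ℕ
  Cfg181 : Type
  restr122 : Cfg181 → Prop
  fn13h : Cfg181 → Prop
  restr123 : Cfg181 → Prop
  fn14h : Cfg181 → Prop
  I183 : Type
  Comp183 : Type
  Cfg183 : Type
  compOf : I183 → Comp183
  restrictTo : Comp183 → Cfg183 → Cfg183
  chi183 : I183 → Cfg183 → ℝ
  Cfg129 : Type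
  new129 : Cfg129 → Prop
  old129 : Cfg129 → Prop
  I184 : Type
  v184 : I184 → ℝ
  C184 : ℝ
  δ'j : ℝ
  εj : ℝ
  I148 : Type
  dev148 : I148 → ℝ
  dev148' : I148 → ℝ
  s148 : I148 → ℝ
  εE148 : I148 → ℝ
  α : ℝ
  β : ℝ
  H157 : ℝ
  Lpow157 : ℝ
  sumR : ℝ
  Rk : ℝ
  Rj : ℝ
  d : ℝ
  εj157 : ℝ
  β₀ : ℝ
  Pt163 : Type
  Ω163 : ℕ → Set Pt163
  D163 : ℕ → Set (Set Pt163)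
  Zj1 : Set Pt163
  Zppj1 : Set Pt163
  j163 : ℕ
  terms163 : Set (Set Pt163)

/-- **BLOCK 36 BUNDLE — the printed statements of [Balaban1989LargeFieldI] pp. 175–190 AS HYPOTHESES, BY NAME.**  One field per
statement, each a reference to the declaration of record typing it (nothing restated): `m04` — (0.4) p. 176 «It satisfies the basic
normalization property ∫dV(𝐑ρ)(V) = ∫dVρ(V)» (`B15.Normalization04`); `m06` — (0.5)–(0.6) p. 176 «(𝐑ρ)(V) = Σ_{Z″}ρ(Z″, V)
exp Σ_X 𝐑(X, V)» (`B15.ExpForm06`); `pos03` — the p. 176 proviso (`Proviso03Printed`); `isN0` ∕ `c179` ∕ `nGt` — p. 179 «Take the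
smallest positive integer N₀ such, that L^{−N₀+1}MR_{k−N₀+1} = M. It is easy to see that either there is exactly one such integer, or
there are two. We assume that N > N₀» (`B15Claim179.IsN0`, `B15Claim179.Claim179`); `c181a` ∕ `c181b` — p. 181 «The restrictions in
the function (1.22) imply that the characteristic functions (1.3) for j = h and □ ⊂ (Ω^∼_{h+1})ᶜ∖Z_h are equal to 1» ∕ «the
restrictions in (1.23) imply that all the functions (1.4) for j = h are equal to 1» (the schematic shape `B15.BasicStep.Claim129`);
`loc183` — the p. 183 locality sentence (`Localized183Printed`); `c129` — (1.29) p. 183 «the restrictions introduced by the new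
characteristic functions imply that the functions (1.3), (1.4), (1.5), (1.7), (1.8), χ_k^{(n)} are equal to 1» (`B15.BasicStep.Claim129`,
the declaration of record of row B15.Eq1.29); `c184` — p. 184 «From the restrictions (1.27) we get the bound O(1)δ′_j < ε_j, hence the
functions (1.5) are equal to 1 also» (`B15Claim184.Claim184`, every contour variable); `i148` — (1.48) p. 186 «|U^{(n)}_{k,Z}(∂p) − 1| ≦
|U^{(n+1)}_{k,Z}(∂p) − 1|(1 + αβ2^{−(j−i)}) + αβ2^{−(j−i)}ε_i(L^{k−i}η)² for p∈B^i(y)» (`B15.BasicStep.Ineq148`); `i157` — (1.57)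
p. 188 (`B15.BasicStep.Ineq157`, with `B₃`, `δ`, `M`, `ε_k` of `W`); `c163` — (1.63) p. 189 «the summation is over the
localization domains X satisfying the following properties: X ⊂ Ω^c_{m+1} for some m ≧ j + 1, X∩Ω_m ≠ ∅, X∈𝔻_m, and
X∩(Z_{j+1}∖Z″_{j+1}) ≠ ∅» (`B15Rep163.Cond163` ∕ `doms163`).  Hypothesis slot only; `m04`, `m06` are literally the two members
of `DagBinding.B15Leaf W` printed on pp. 175–190 (`b15Leaf_of_hyps`).  **v1.1 (check-1 g0 M-c1-1, 2026-08-28T10:39:20Z): the slot `pos03` of this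
v1 bundle is stronger than print (see `Proviso03Printed`); CONSUME `Hyp1` (§3) instead — `Hyp → Hyp1` (`Hyp.toHyp1`); kept
unchanged, append-only.**
[cite: Balaban1989LargeFieldI, (0.3)–(0.6) p.176, p.179, p.181, (1.29) p.183, p.184, (1.48) p.186, (1.57) p.188, (1.63) p.189] -/
structure Hyp (W : PrintedCarriers15) (X : Carriers W) : Prop where
  m04 : B15.Normalization04 W.D
  m06 : B15.ExpForm06 W.D W.Zpp W.ρpp W.Rsum
  pos03 : Proviso03Printed W.D
  isN0 : IsN0 X.s X.k X.N₀
  c179 : Claim179 X.s X.k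
  nGt : X.N₀ < X.N
  c181a : Claim129 X.restr122 X.fn13h
  c181b : Claim129 X.restr123 X.fn14h
  loc183 : Localized183Printed X.compOf X.restrictTo X.chi183
  c129 : Claim129 X.new129 X.old129
  c184 : ∀ b : X.I184, Claim184 (X.v184 b) X.C184 X.δ'j X.εj
  i148 : ∀ q : X.I148, Ineq148 (X.dev148 q) (X.dev148' q) X.α X.β (X.s148 q) (X.εE148 q)
  i157 : Ineq157 X.H157 X.Lpow157 W.B₃ W.δ W.M X.sumR X.Rk X.Rj X.d W.εk X.εj157 X.β₀
  c163 : X.terms163 ⊆ doms163 X.Ω163 X.D163 X.Zj1 X.Zppj1 X.j163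

variable {W : PrintedCarriers15} {X : Carriers W}

/-- **The consumer's form — blocks 36 + 37 assemble the DAG leaf.**  The block-36 bundle supplies (0.4) and (0.5)–(0.6); the
block-37 bundle `B15Carve37Prop1RprimeHyp.Hyp` supplies Proposition 1, (1.80), (1.89), (1.102); together they give the `rBasicStep`
leaf `DagBinding.B15Leaf W` of node n12 [B15] (K1⁷ consumer) with no further hypothesis. Bookkeeping.
[cite: Balaban1989LargeFieldI, (0.4)–(0.6) p.176, Prop. 1 (1.78) p.194] -/
theorem b15Leaf_of_hyps {X' : B15Carve37Prop1RprimeHyp.Carriers W} (h36 : Hyp W X)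
    (h37 : B15Carve37Prop1RprimeHyp.Hyp W X') : B15Leaf W :=
  h37.b15Leaf h36.m04 h36.m06

/-- Conversely the DAG leaf carries the bundle's two (0.4)/(0.6) members. Bookkeeping. [cite: Balaban1989LargeFieldI, (0.4)–(0.6) p.176] -/
theorem shared_of_b15Leaf (hL : B15Leaf W) :
    B15.Normalization04 W.D ∧ B15.ExpForm06 W.D W.Zpp W.ρpp W.Rsum :=
  ⟨hL.n04, hL.e06⟩

/-- (0.3) is well defined under the bundle: no denominator vanishes (p. 176). [cite: Balaban1989LargeFieldI, (0.3) p.176] -/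
theorem Hyp.den_ne_zero (h : Hyp W X) (Z : W.D.Reg) : W.D.IntOver (W.D.Zp Z) (W.D.ρ (W.D.Zpp Z)) ≠ 0 :=
  den_ne_zero_of_proviso03 h.pos03 Z

/-- p. 179 out of the bundle: `N₀` is a solution of the defining equation, there are at most two solutions, and `N₀ < N`.
Bookkeeping (`B15Claim179.sols`). [cite: Balaban1989LargeFieldI, p.179] -/
theorem Hyp.n0_facts (h : Hyp W X) : X.N₀ ∈ sols X.s X.k ∧ (sols X.s X.k).card ≤ 2 ∧ X.N₀ < X.N := by
  refine ⟨h.isN0.1, ?_, h.nGt⟩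
  rcases h.c179 with h1 | h2
  · omega
  · omega

/-- (1.29) out of the bundle in the printed form of an equality of `{0,1}`-valued functions, `χ_new · χ_old = χ_new`
(`B15.BasicStep.claim129_iff_indicator`). [cite: Balaban1989LargeFieldI, (1.29) p.183] -/
theorem Hyp.c129_indicator (h : Hyp W X) [DecidablePred X.new129] [DecidablePred X.old129] :
    ∀ U, (if X.new129 U then (1 : ℝ) else 0) * (if X.old129 U then 1 else 0) = if X.new129 U then 1 else 0 :=
  (B15.BasicStep.claim129_iff_indicator X.new129 X.old129).1 h.c129

/-- p. 184 out of the bundle: every contour variable satisfies `|V_j(y, x) − 1| < ε_j`, i.e. the (1.5)-functions equal 1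
(`B15Claim184.claim184_conclusion`). [cite: Balaban1989LargeFieldI, p.184, (1.5) p.178] -/
theorem Hyp.sf15_of_c184 (h : Hyp W X) (b : X.I184) : X.v184 b < X.εj :=
  B15Claim184.claim184_conclusion (h.c184 b)

/-- (1.63) out of the bundle: every summation domain has a scale `m ≧ j + 1` with the four printed properties.
[cite: Balaban1989LargeFieldI, (1.63) p.189] -/
theorem Hyp.cond163_of_mem (h : Hyp W X) {Y : Set X.Pt163} (hY : Y ∈ X.terms163) :
    ∃ m, Cond163 X.Ω163 X.D163 X.Zj1 X.Zppj1 X.j163 m Y :=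
  h.c163 hY

/-! ## §3  v1.1 (lane-1 SECOND READ, check-1 g0 M-c1-1, 2026-08-28T10:39:20Z; append-only — every v1 declaration above is unchanged):
## the p. 176 proviso in print's strength and the bundle `Hyp1` -/

/-- **p. 176, ll. 14–16 [PDF 2]** (`p0002.txt:L14–L16`) — **v1.1 form of the proviso printed under (0.3)**, verbatim: «We will
prove that the densities are positive, and the in[t]egration domains in the integrals above are nonempty, hence the
denominators are positive, and the operation 𝐑 is well defined.»  The pieces `ρ(Z, ·)` of (0.2) ∕ (1.2) CARRY the sharp
characteristic functions `χ({…})` (1.3)–(1.5), (1.7)–(1.9) of p. 178 [PDF 4] (`p0004.txt:L13–L24`) — their supports are «the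
integration domains» of the sentence — and vanish off them; so «the densities are positive» is positivity ON the (nonempty)
integration domains.  TYPED over the abstract integration datum `D : B15.RData` (which has no separate notion of integration
domain) exactly as the tree's own (0.4) theorems read this proviso (`B15.BasicStep.integral_ropReal_eq`: `h0 : 0 ≤ piece Z V`,
`hden : … ≠ 0`; `B15LeafKnit.normalization04_knit`: the same; `B15LeafKnitMass`: the MASS form `0 ≤ piece`, `0 < ∫dV piece`,
GAPS G-B15-01): the pieces are NONNEGATIVE and every denominator
`∫dV⌈_{Z′}ρ(Z″, V)` of (0.3) is POSITIVE.  **v1.1 CORRECTION** (check-1 g0 second read M-c1-1, 2026-08-28T10:39:20Z, `carve/CHECK-1.md`;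
self-probe `carve/carve-36/Probe36.lean`, `Probe36.not_hyp_faithful`): v1's `Proviso03Printed` asks `0 < D.ρ Z V` at EVERY
configuration, which is stronger than print and is refuted by any piece carrying (1.3)–(1.9) (one vanishing value makes v1's
`Hyp W X` false for every `X`); v1 is kept (append-only) and implies v1.1 (`proviso03Printed1_of_v1`).
[cite: Balaban1989LargeFieldI, (0.3) p.176 ll.14–16; (1.3)–(1.9) p.178] -/
def Proviso03Printed1 (D : B15.RData) : Prop :=
  (∀ (Z : D.Reg) (V : D.Vsp), 0 ≤ D.ρ Z V) ∧ ∀ Z : D.Reg, 0 < D.IntOver (D.Zp Z) (D.ρ (D.Zpp Z))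

/-- v1 ⇒ v1.1 (strict positivity of the pieces implies their nonnegativity; the denominator clause is the same).
Bookkeeping. [cite: Balaban1989LargeFieldI, (0.3) p.176 ll.14–16] -/
theorem proviso03Printed1_of_v1 {D : B15.RData} (h : Proviso03Printed D) : Proviso03Printed1 D :=
  ⟨fun Z V => (h.1 Z V).le, h.2⟩

/-- «hence the denominators are positive, and the operation 𝐑 is well defined» from the v1.1 proviso: no denominator of
(0.3) (`B15.Rop`) vanishes. Bookkeeping. [cite: Balaban1989LargeFieldI, (0.3) p.176 ll.14–16] -/
theorem den_ne_zero_of_proviso03Printed1 {D : B15.RData} (h : Proviso03Printed1 D) (Z : D.Reg) :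
    D.IntOver (D.Zp Z) (D.ρ (D.Zpp Z)) ≠ 0 :=
  (h.2 Z).ne'

/-- **BLOCK 36 BUNDLE, v1.1** — `Hyp` with the p. 176 proviso slot in print's strength (`pos03 : Proviso03Printed1 W.D`:
nonnegative pieces, positive denominators); the other fourteen fields are those of `Hyp` verbatim (same declarations of
record, same carriers): `m04` (0.4), `m06` (0.5)–(0.6), `isN0` ∕ `c179` ∕ `nGt` p. 179, `c181a` ∕ `c181b` p. 181, `loc183`
p. 183, `c129` (1.29), `c184` p. 184, `i148` (1.48), `i157` (1.57), `c163` (1.63).  This is the bundle a node prover should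
take (`(h : Hyp1 W X)`); v1's `Hyp` implies it (`Hyp.toHyp1`).  Hypothesis slot only.
[cite: Balaban1989LargeFieldI, (0.3)–(0.6) p.176, p.179, p.181, (1.29) p.183, p.184, (1.48) p.186, (1.57) p.188, (1.63) p.189] -/
structure Hyp1 (W : PrintedCarriers15) (X : Carriers W) : Prop where
  m04 : B15.Normalization04 W.D
  m06 : B15.ExpForm06 W.D W.Zpp W.ρpp W.Rsum
  pos03 : Proviso03Printed1 W.D
  isN0 : IsN0 X.s X.k X.N₀
  c179 : Claim179 X.s X.k
  nGt : X.N₀ < X.N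
  c181a : Claim129 X.restr122 X.fn13h
  c181b : Claim129 X.restr123 X.fn14h
  loc183 : Localized183Printed X.compOf X.restrictTo X.chi183
  c129 : Claim129 X.new129 X.old129
  c184 : ∀ b : X.I184, Claim184 (X.v184 b) X.C184 X.δ'j X.εj
  i148 : ∀ q : X.I148, Ineq148 (X.dev148 q) (X.dev148' q) X.α X.β (X.s148 q) (X.εE148 q)
  i157 : Ineq157 X.H157 X.Lpow157 W.B₃ W.δ W.M X.sumR X.Rk X.Rj X.d W.εk X.εj157 X.β₀
  c163 : X.terms163 ⊆ doms163 X.Ω163 X.D163 X.Zj1 X.Zppj1 X.j163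

/-- The v1 bundle implies the v1.1 bundle (only the proviso slot is weakened). Bookkeeping.
[cite: Balaban1989LargeFieldI, (0.3) p.176 ll.14–16] -/
theorem Hyp.toHyp1 (h : Hyp W X) : Hyp1 W X :=
  ⟨h.m04, h.m06, proviso03Printed1_of_v1 h.pos03, h.isN0, h.c179, h.nGt, h.c181a, h.c181b, h.loc183, h.c129, h.c184,
    h.i148, h.i157, h.c163⟩

/-- **The consumer's form from the v1.1 bundle** — blocks 36 (v1.1) + 37 assemble the DAG leaf `DagBinding.B15Leaf W` of node
n12 [B15] with no further hypothesis. Bookkeeping. [cite: Balaban1989LargeFieldI, (0.4)–(0.6) p.176, Prop. 1 (1.78) p.194] -/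
theorem b15Leaf_of_hyp1 {X' : B15Carve37Prop1RprimeHyp.Carriers W} (h36 : Hyp1 W X)
    (h37 : B15Carve37Prop1RprimeHyp.Hyp W X') : B15Leaf W :=
  h37.b15Leaf h36.m04 h36.m06

/-- (0.3) is well defined under the v1.1 bundle: no denominator vanishes (p. 176). [cite: Balaban1989LargeFieldI, (0.3) p.176] -/
theorem Hyp1.den_ne_zero (h : Hyp1 W X) (Z : W.D.Reg) : W.D.IntOver (W.D.Zp Z) (W.D.ρ (W.D.Zpp Z)) ≠ 0 :=
  den_ne_zero_of_proviso03Printed1 h.pos03 Z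

/-- The pieces are nonnegative under the v1.1 bundle (p. 176 «the densities are positive», on their integration domains).
[cite: Balaban1989LargeFieldI, (0.3) p.176 ll.14–16] -/
theorem Hyp1.piece_nonneg (h : Hyp1 W X) (Z : W.D.Reg) (V : W.D.Vsp) : 0 ≤ W.D.ρ Z V :=
  h.pos03.1 Z V

/-- p. 179 out of the v1.1 bundle: `N₀` solves the defining equation, there are at most two solutions, `N₀ < N`.
Bookkeeping. [cite: Balaban1989LargeFieldI, p.179] -/
theorem Hyp1.n0_facts (h : Hyp1 W X) : X.N₀ ∈ sols X.s X.k ∧ (sols X.s X.k).card ≤ 2 ∧ X.N₀ < X.N := by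
  refine ⟨h.isN0.1, ?_, h.nGt⟩
  rcases h.c179 with h1 | h2
  · omega
  · omega

/-- (1.29) out of the v1.1 bundle as the printed equality `χ_new · χ_old = χ_new` of `{0,1}`-valued functions.
[cite: Balaban1989LargeFieldI, (1.29) p.183] -/
theorem Hyp1.c129_indicator (h : Hyp1 W X) [DecidablePred X.new129] [DecidablePred X.old129] :
    ∀ U, (if X.new129 U then (1 : ℝ) else 0) * (if X.old129 U then 1 else 0) = if X.new129 U then 1 else 0 :=
  (B15.BasicStep.claim129_iff_indicator X.new129 X.old129).1 h.c129

/-- p. 184 out of the v1.1 bundle: every contour variable satisfies `|V_j(y, x) − 1| < ε_j`.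
[cite: Balaban1989LargeFieldI, p.184, (1.5) p.178] -/
theorem Hyp1.sf15_of_c184 (h : Hyp1 W X) (b : X.I184) : X.v184 b < X.εj :=
  B15Claim184.claim184_conclusion (h.c184 b)

/-- (1.63) out of the v1.1 bundle: every summation domain has a scale `m ≧ j + 1` with the four printed properties.
[cite: Balaban1989LargeFieldI, (1.63) p.189] -/
theorem Hyp1.cond163_of_mem (h : Hyp1 W X) {Y : Set X.Pt163} (hY : Y ∈ X.terms163) :
    ∃ m, Cond163 X.Ω163 X.D163 X.Zj1 X.Zppj1 X.j163 m Y :=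
  h.c163 hY

/-! ## §4  v1.2 (lead g32 RULING #13 (A), 2026-08-28T10:44:00Z ∕ carve/STATUS 10:47Z; append-only): the kernel RECORD of
## M-c1-1 and the joint non-degenerate MODEL of `Hyp1` on a faithful (vanishing-capable) carrier, in file -/

/-- **RECORD (M-c1-1, kernel form).** If ONE piece `ρ(Z, ·)` of the (0.2) datum vanishes at ONE configuration — as every piece
carrying a sharp characteristic function (1.3)–(1.5), (1.7)–(1.9) of p. 178 that is not identically 1 does — then the v1 bundle
`Hyp W X` is false for EVERY `X` (its slot `pos03`, conjunct 1, is contradicted).  At the tree's pinned [IV] carrier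
`B15LeafKnit.knitW15 κ` (`D.ρ := κ.piece`) this is check-1 g0's `P36.not_hyp_knitW15`; the tree's census of the same point is
`B15LeafKnitMass` (GAPS G-B15-01: even the pointwise fibre proviso fails at a χ-piece; the (0.3)/(0.4) chain is re-issued on the MASS
form).  Bookkeeping. [cite: Balaban1989LargeFieldI, (0.3) p.176 ll.14–16; (1.3)–(1.9) p.178] -/
theorem not_hyp_of_piece_zero (Z : W.D.Reg) (V : W.D.Vsp) (h0 : W.D.ρ Z V = 0) (X : Carriers W) : ¬ Hyp W X :=
  fun h => (h.pos03.1 Z V).ne' h0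

/-- Filler lattice parameters `d = 1`, `L = 3`, `m = K = 0` for the fields of `PrintedCarriers15` that block 36 does not read
(model data only). [folklore] -/
def fillParams : Params where
  d := 1
  L := 3
  m := 0
  K := 0
  hd := le_rfl
  hL := ⟨⟨1, rfl⟩, by norm_num⟩

/-- Filler Proposition-1 carrier (not read by block 36; model data only). [folklore] -/
def fillLF : B15.LFVar :=
  ⟨Unit, fun _ => 1, fun _ => Unit, fun _ => Unit, fun _ _ _ => True, fun _ _ _ => True, fun _ _ _ => True,
    fun _ _ => 0, fun _ _ _ => True⟩

/-- A `PrintedCarriers15` record with prescribed (0.2)–(0.6) data `D, Zpp, ρpp, Rsum` and reals `B₃, δ, M, ε_k`; the fields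
block 36 does not read are filled with `U(1)`-valued trivial data (`Matrix.unitaryGroup (Fin 1) ℂ` with the tree's `GaugeGroup` ∕
`HaarData` instances of `UnitaryModel`).  Model data only. [folklore] -/
@[reducible] def fillW (D : B15.RData) (Zpp : Type) [Fintype Zpp] (ρpp Rsum : Zpp → D.Vsp → ℝ) (B₃ δ M εk : ℝ) :
    PrintedCarriers15 where
  D := D
  Zpp := Zpp
  instZ := inferInstance
  ρpp := ρpp
  Rsum := Rsum
  LF := fillLF
  Plaq := Unit
  dev180 := fun _ => 0
  distΛ := fun _ => 0
  εk := εk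
  η := 1
  B₃ := B₃
  B₅ := 1
  M := M
  δ := δ
  C180 := 1
  Cfg := Unit
  remaining := fun _ => True
  dropped := fun _ => True
  P15 := fillParams
  j15 := 0
  G15 := Matrix.unitaryGroup (Fin 1) ℂ
  instGG15 := inferInstance
  instMS15 := inferInstance
  instHD15 := inferInstance
  Rprime := id
  ρk := fun _ => 1

/-- **Two-region (0.2) datum** (a model of p. 176's setting with two configurations): `V ∈ {tt, ff}` («large» ∕ «small»),
large-field regions `Z ∈ {tt, ff}` («the cube» ∕ «∅»), `∫dV f = f tt + f ff`, `∫dV⌈_{Z′} := ∫dV` (a number, as the tree's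
`B15LeafKnit.knitRData`), `Z′ := Z`, `Z″ := ∅` for both regions (everything is renormalized), pieces `ρ`.  Here (0.3) reads
`(𝐑ρ)(V) = ρ(∅, V)·(∫ρ(cube) + ∫ρ(∅))/∫ρ(∅)`: 𝐑 moves the mass of the large-field piece onto the small-field piece.
[cite: Balaban1989LargeFieldI, (0.2)–(0.3) p.176] -/
@[reducible] def twoRegionDatum (ρ : Bool → Bool → ℝ) : B15.RData where
  Vsp := Bool
  Reg := Bool
  instF := inferInstance
  Int := fun f => f true + f false
  IntOver := fun _ f => f true + f false
  Zp := id
  Zpp := fun _ => false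
  ρ := ρ

/-- (0.3) on the two-region datum, unfolded. Bookkeeping. [cite: Balaban1989LargeFieldI, (0.3) p.176] -/
theorem rop_twoRegion (ρ : Bool → Bool → ℝ) (V : Bool) :
    B15.Rop (twoRegionDatum ρ) V = ρ false V * ((ρ true true + ρ true false) / (ρ false true + ρ false false))
      + ρ false V * ((ρ false true + ρ false false) / (ρ false true + ρ false false)) := by
  show ∑ Z : Bool, ρ false V * ((ρ Z true + ρ Z false) / (ρ false true + ρ false false)) = _
  rw [Fintype.sum_bool]

/-- (0.4) HOLDS on the two-region datum as soon as the denominator `∫ρ(∅)` is non-zero. [cite: Balaban1989LargeFieldI, (0.4) p.176] -/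
theorem normalization04_twoRegion (ρ : Bool → Bool → ℝ) (hden : ρ false true + ρ false false ≠ 0) :
    B15.Normalization04 (twoRegionDatum ρ) := by
  show B15.Rop (twoRegionDatum ρ) true + B15.Rop (twoRegionDatum ρ) false
    = (∑ Z : Bool, ρ Z true) + ∑ Z : Bool, ρ Z false
  rw [rop_twoRegion, rop_twoRegion, Fintype.sum_bool, Fintype.sum_bool]
  field_simp
  ring

/-- (0.5)–(0.6) HOLD on the two-region datum with ONE region `Z″ = ∅`, kept piece `ρ(∅, ·)` and exponent sum
`Σ_X 𝐑(X) = log((∫ρ(cube) + ∫ρ(∅))/∫ρ(∅))` ((0.5): `Σ_{Z′⊂Z″ᶜ} ∫ρ(Z′∪Z″)/∫ρ(Z″) = exp Σ_X 𝐑(X)`).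
[cite: Balaban1989LargeFieldI, (0.5)–(0.6) p.176] -/
theorem expForm06_twoRegion (ρ : Bool → Bool → ℝ) (hden : 0 < ρ false true + ρ false false)
    (htot : 0 < ρ true true + ρ true false + (ρ false true + ρ false false)) :
    B15.ExpForm06 (twoRegionDatum ρ) Unit (fun _ V => ρ false V)
      (fun _ _ => Real.log ((ρ true true + ρ true false + (ρ false true + ρ false false)) /
        (ρ false true + ρ false false))) := by
  intro V
  show B15.Rop (twoRegionDatum ρ) V = ∑ _z : Unit, ρ false V *
    Real.exp (Real.log ((ρ true true + ρ true false + (ρ false true + ρ false false)) / (ρ false true + ρ false false)))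
  rw [Fintype.sum_unique, Real.exp_log (div_pos htot hden), rop_twoRegion]
  field_simp

/-- **FAITHFUL pieces**: `ρ(Z, V) = χ_Z(V)·w_Z`, the characteristic function of «the large-field region of `V` is `Z`» times a
positive weight (`w_cube = 1/4`, `w_∅ = 3/4`) — the cube's piece VANISHES at the small configuration, as a piece carrying (1.3)–(1.9)
does off its support. [cite: Balaban1989LargeFieldI, (1.3)–(1.9) p.178] -/
def chiPiece : Bool → Bool → ℝ
  | true, true => 1/4
  | true, false => 0
  | false, true => 0
  | false, false => 3/4

/-- The faithful carrier of the model: the two-region datum with χ-pieces, one (0.6) region `Z″ = ∅` with exponent sum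
`log(4/3)`, and `B₃ = δ = M = 1`, `ε_k = 1/100`. Model data only. [cite: Balaban1989LargeFieldI, (0.2)–(0.6) p.176] -/
@[reducible] def faithfulW : PrintedCarriers15 :=
  fillW (twoRegionDatum chiPiece) Unit (fun _ V => chiPiece false V)
    (fun _ _ => Real.log ((chiPiece true true + chiPiece true false + (chiPiece false true + chiPiece false false)) /
      (chiPiece false true + chiPiece false false))) 1 1 1 (1/100)

/-- **RECORD (M-c1-1) on the faithful datum**: v1's `Proviso03Printed` is FALSE there (conjunct 1 at the cube's piece and the
small configuration), although its pieces are ≥ 0, its denominators > 0 and (0.4), (0.6) hold (`hyp1_faithful`).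
[cite: Balaban1989LargeFieldI, (0.3) p.176 ll.14–16] -/
theorem not_proviso03Printed_faithful : ¬ Proviso03Printed (twoRegionDatum chiPiece) := by
  intro h
  have : (0:ℝ) < chiPiece true false := h.1 true false
  norm_num [chiPiece] at this

/-- **RECORD (M-c1-1)**: the v1 bundle is false over the faithful datum for EVERY choice of the block's other carriers.
[cite: Balaban1989LargeFieldI, (0.3) p.176 ll.14–16] -/
theorem not_hyp_faithful (X : Carriers faithfulW) : ¬ Hyp faithfulW X :=
  not_hyp_of_piece_zero (W := faithfulW) true false (by show chiPiece true false = 0; norm_num [chiPiece]) X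

/-- Size exponents `R_j = L` for all `j` (model data: `N₀ = 2` at `k = 3`). [folklore] -/
def fillSizes : ℕ → ℕ := fun _ => 1

/-- The solution set of the `N₀`-equation of p. 179 for the model sizes at `k = 3` is `{2}`. Bookkeeping. [cite: Balaban1989LargeFieldI, p.179] -/
theorem sols_fillSizes : sols fillSizes 3 = {2} := by
  ext N
  rw [B15Claim179.mem_sols, Finset.mem_singleton]
  show (1 ≤ N ∧ N ≤ 3) ∧ fillSizes (3 - N + 1) = N - 1 ↔ N = 2
  simp only [fillSizes]
  omega

/-- The block's other carriers for the model: every index type inhabited, printed constants `β = 1/2`, `α = 1/8`, `β₀ = 0`, the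
three (1.29)-shape slots as STRICT implications `|U − 1| < 1/20 ⇒ |U − 1| < 1/10`, genuine per-component indicator functions for
p. 183, a NON-empty (1.63) summation domain. Model data only. [folklore] -/
@[reducible] def faithfulX : Carriers faithfulW where
  s := fillSizes
  k := 3
  N₀ := 2
  N := 3
  Cfg181 := ℝ
  restr122 := fun U => |U - 1| < 1/20
  fn13h := fun U => |U - 1| < 1/10
  restr123 := fun U => |U - 1| < 1/20
  fn14h := fun U => |U - 1| < 1/10
  I183 := Bool
  Comp183 := Bool
  Cfg183 := Bool → ℝ
  compOf := id
  restrictTo := fun c V c' => if c' = c then V c' else 0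
  chi183 := fun i V => if |V i - 1| < 1/10 then 1 else 0
  Cfg129 := ℝ
  new129 := fun U => |U - 1| < 1/20
  old129 := fun U => |U - 1| < 1/10
  I184 := Bool
  v184 := fun _ => 1/100
  C184 := 3
  δ'j := 1/100
  εj := 1/10
  I148 := Bool
  dev148 := fun _ => 1/10
  dev148' := fun _ => 1/10
  s148 := fun _ => 1/2
  εE148 := fun _ => 1/100
  α := 1/8
  β := 1/2
  H157 := 0
  Lpow157 := 1
  sumR := 0
  Rk := 2
  Rj := 1
  d := 1
  εj157 := 1/100
  β₀ := 0
  Pt163 := Unit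
  Ω163 := fun m => {_x | m ≤ 1}
  D163 := fun _ => Set.univ
  Zj1 := Set.univ
  Zppj1 := ∅
  j163 := 0
  terms163 := {Set.univ}

/-- **THE JOINT NON-DEGENERATE MODEL OF THE v1.1 BUNDLE ON THE FAITHFUL CARRIER**: all 15 slots of `Hyp1` hold at
`(faithfulW, faithfulX)` — the repaired proviso (pieces ≥ 0, denominators `3/4 > 0`), (0.4) and (0.6) genuinely (𝐑 non-identity,
exponent sum `log(4/3)`), and the 13 block-internal slots with the printed constants.  (v1's `Hyp` is false at the same carrier:
`not_hyp_faithful`.) [cite: Balaban1989LargeFieldI, (0.3)–(0.6) p.176, p.179, p.181, (1.29) p.183, p.184, (1.48) p.186, (1.57) p.188, (1.63) p.189] -/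
theorem hyp1_faithful : Hyp1 faithfulW faithfulX where
  m04 := normalization04_twoRegion chiPiece (by norm_num [chiPiece])
  m06 := expForm06_twoRegion chiPiece (by norm_num [chiPiece]) (by norm_num [chiPiece])
  pos03 := ⟨fun Z V => by show (0:ℝ) ≤ chiPiece Z V; cases Z <;> cases V <;> norm_num [chiPiece],
    fun _ => by show (0:ℝ) < chiPiece false true + chiPiece false false; norm_num [chiPiece]⟩
  isN0 := by
    refine ⟨?_, fun N hN => ?_⟩
    · show 2 ∈ sols fillSizes 3
      rw [sols_fillSizes]; exact Finset.mem_singleton_self 2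
    · change N ∈ sols fillSizes 3 at hN
      rw [sols_fillSizes, Finset.mem_singleton] at hN
      show 2 ≤ N
      omega
  c179 := Or.inl (by show (sols fillSizes 3).card = 1; rw [sols_fillSizes, Finset.card_singleton])
  nGt := by show (2:ℕ) < 3; norm_num
  c181a := fun U (hU : |U - 1| < 1/20) => show |U - 1| < 1/10 from hU.trans (by norm_num)
  c181b := fun U (hU : |U - 1| < 1/20) => show |U - 1| < 1/10 from hU.trans (by norm_num)
  loc183 := by
    intro i V
    show (if |V i - 1| < 1/10 then (1:ℝ) else 0) = if |(if i = i then V i else 0) - 1| < 1/10 then (1:ℝ) else 0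
    rw [if_pos rfl]
  c129 := fun U (hU : |U - 1| < 1/20) => show |U - 1| < 1/10 from hU.trans (by norm_num)
  c184 := fun _ => by show (1/100 : ℝ) < 3 * (1/100) ∧ 3 * (1/100) < (1/10 : ℝ); norm_num
  i148 := fun _ => by
    show (1/10 : ℝ) ≤ 1/10 * (1 + 1/8 * (1/2) * (1/2)) + 1/8 * (1/2) * (1/2) * (1/100); norm_num
  i157 := by
    have h : Real.exp (-2:ℝ) < Real.exp (-1) := Real.exp_lt_exp.2 (by norm_num)
    have e : (-(1 * 10 * 1 * 0) - 1 * 1 * 2 : ℝ) = -2 := by norm_num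
    show (0:ℝ) ≤ 1 * 1 * Real.exp (-(1 * 10 * 1 * 0) - 1 * 1 * 2) * (44 * 1 ^ 2) * 1 * (1/100) ∧
      1 * 1 * Real.exp (-(1 * 10 * 1 * 0) - 1 * 1 * 2) * (44 * 1 ^ 2) * 1 * (1/100)
        < 44 * 1 ^ 2 * 1 ^ 2 * (1 + 0) * Real.exp (-1) * (1/100)
    rw [e]
    simp only [one_pow, one_mul, mul_one, add_zero]
    exact ⟨by positivity, by linarith⟩
  c163 := by
    intro Y hY
    have hY' : Y = Set.univ := hY
    subst hY'
    refine ⟨1, le_rfl, ?_, ?_, Set.mem_univ _, ?_⟩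
    · intro x _
      show ¬ (1 + 1 ≤ 1)
      omega
    · exact ⟨(), Set.mem_univ _, show 1 ≤ 1 from le_rfl⟩
    · exact ⟨(), Set.mem_univ _, Set.mem_univ _, fun h => h⟩

/-- Non-degeneracy of the model: a piece VANISHES (the faithful feature v1 could not accommodate), 𝐑 is NOT the identity
(`(𝐑ρ)(ff) = 1 ≠ 3/4 = Σ_Z ρ(Z, ff)`), the exponent sum is `log(4/3) ≠ 0`, the (1.29) slot is STRICT (`old ∧ ¬ new` inhabited),
the (1.63) summation domain and every index type are non-empty. Bookkeeping. [cite: Balaban1989LargeFieldI, (0.2)–(0.6) p.176] -/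
theorem hyp1_faithful_nondegenerate :
    faithfulW.D.ρ true false = 0 ∧ B15.Rop faithfulW.D false ≠ ∑ Z : Bool, faithfulW.D.ρ Z false ∧
      faithfulW.Rsum () true = Real.log (4/3) ∧ Real.log (4/3) ≠ (0:ℝ) ∧
      (∃ U : faithfulX.Cfg129, faithfulX.old129 U ∧ ¬ faithfulX.new129 U) ∧
      faithfulX.terms163.Nonempty ∧ Nonempty faithfulX.I184 ∧ Nonempty faithfulX.I148 ∧ Nonempty faithfulX.I183 := by
  refine ⟨by show chiPiece true false = 0; norm_num [chiPiece], ?_, ?_, ?_, ⟨(1 + 1/15 : ℝ), ?_, ?_⟩, ⟨Set.univ, rfl⟩,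
    ⟨true⟩, ⟨true⟩, ⟨true⟩⟩
  · show B15.Rop (twoRegionDatum chiPiece) false ≠ ∑ Z : Bool, chiPiece Z false
    rw [rop_twoRegion, Fintype.sum_bool]
    norm_num [chiPiece]
  · show Real.log ((chiPiece true true + chiPiece true false + (chiPiece false true + chiPiece false false)) /
      (chiPiece false true + chiPiece false false)) = Real.log (4/3)
    norm_num [chiPiece]
  · have : (0:ℝ) < Real.log (4/3) := Real.log_pos (by norm_num)
    exact this.ne'
  · show |(1 + 1/15 : ℝ) - 1| < 1/10
    rw [abs_of_nonneg (by norm_num)]; norm_num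
  · show ¬ |(1 + 1/15 : ℝ) - 1| < 1/20
    rw [abs_of_nonneg (by norm_num)]; norm_num

/-- The consumer's leaf is reached from the model bundle (with any block-37 bundle over the same carrier). Bookkeeping.
[cite: Balaban1989LargeFieldI, (0.4)–(0.6) p.176, Prop. 1 (1.78) p.194] -/
theorem b15Leaf_faithful_of_hyp37 {X' : B15Carve37Prop1RprimeHyp.Carriers faithfulW}
    (h37 : B15Carve37Prop1RprimeHyp.Hyp faithfulW X') : B15Leaf faithfulW :=
  b15Leaf_of_hyp1 hyp1_faithful h37

end Literature.MathematicalPhysics.QuantumFieldTheory.Balaban1983to89.B15Carve36BasicStepHyp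

end
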